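import Summits.AtomisticToContinuum.HydrodynamicLimit.Theorems.CollisionIsometryCLTAdaptedWeightCLTBHCoarseningOrbit
import Summits.AtomisticToContinuum.HydrodynamicLimit.Theorems.CollisionIsometryCLTAdaptedWeightCLTBHCoarseningKernel
import Summits.AtomisticToContinuum.HydrodynamicLimit.Theorems.CollisionIsometryCLTAdaptedWeightCLTTLPastDampingScales

/-!
# Stub `stub_coarsening` (S6) of the line `block-h-dissipation-closure` for the crux `AdaptedWeightCLT`
(stmt-AtomisticToContinuum-14868, rev-12 TIME-LOCAL form; `--supports`): COARSENING, CELLS ⇒ BLOCKS, CONDITIONAL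
ON THE SUB-BLOCK REYNOLDS REMAINDER

THE STATEMENT LANDED HERE (`bhCoarsening_of_reynolds`, registered anchor) is the registered stub `stub_coarsening`
with ONE extra hypothesis inserted after `TailsOn σ a₀ θ₀ u₀ Φ t`: the sub-block Reynolds remainder of the block
family `φ` vanishes in probability for every admissible cell family at the cell exponent `γc`,
`SubBlockReynoldsOn σ a₀ θ₀ u₀ Φ γc φ t` (typed here over the ψ-smeared functionals `ethG · reyG` of the Germano
split, `ReynG`; the twin of the declared exposure `SustainedAnisotropy.ReynoldsStub` of the line
`sustained-anisotropy-superexp`, whose `ReynInt` samples the cell velocities at the particles instead of smearing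
them). Part (ii) of the stub — `TailsOn ⇒ SubBlockReynoldsOn` for every flow and every `t > 0` — is the hydro-class
exposure of the crux (pre-shock it is `GermanoSplitLES.MesoQuiescence`-class; post-shock sub-block
Kelvin–Helmholtz/Richtmyer–Meshkov turbulence would refute it together with the crux, Disproof §1c/§6) and is
NOT asserted.

THE PROOF of part (i) (`kineticClosureOn_of_cell`, one cell family). Fix an admissible block family `φ`
(`0 < γ ≤ 1/15`) and an admissible cell family `ψ` (`γc > 1/6`). For every `N`, on the good set of the flow,
the Germano inequality integrated over `[0, t] × 𝕋³` (`Coarsening.xint_le_orbit`) reads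
`X_φ ≤ 4 X_ψ + K_N ∫₀ᵗ m₆ + 1260 ReynG`, `K_N = 144 ε_N² R_N³ |B₁| 80 ≤ const · (N+1)^{5γ − 2γc} → 0`
(`5γ ≤ 1/3 < 2γc`: this is where `γ ≤ 1/15` and `γc > 1/6` meet), and `∫₀ᵗ m₆ ≤ 2t + 720 λ⁻⁶ ∫₀ᵗ expMoment λ`
(`Coarsening.integral_m6_le`). Hence, for large `N`,
`{δ < X_φ} ⊆ goodᶜ ∪ {δ/12 < X_ψ} ∪ {δ/3780 < ReynG} ∪ {Cexp < ∫₀ᵗ ∫ e^{λ|v|²}}`: the first set is null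
(`ae_mem_good_localGibbsLaw`), the other three have probability `→ 0` by cell closure, the Reynolds hypothesis and
H2 (`TailsOn`). The crux's `let ρb mb ub D q` telescope is `DefectSq` by the landed dictionary
(`Reduction.cruxIntegrand_eq`, `kineticClosureOn_iff_defectSq`). For the registered form, ONE admissible cell family
at exponent `γc` exists (`Coarsening.exists_admissibleKernel`, the torus mollifier).
-/

namespace Summit.AtomisticToContinuum.HydrodynamicLimit.Theorems.BlockHDissipation

open scoped BigOperators Topology Classical MeasureTheory ENNReal InnerProductSpace
open Filter Set MeasureTheory
open Literature.Analysis.FluidPDE Literature.Analysis.FluidPDE.Torus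
open Summit.AtomisticToContinuum.HydrodynamicLimit.Theorems.ContactSourceDuhamel
open Summit.AtomisticToContinuum.HydrodynamicLimit.Theorems.ContactSourceDuhamel.TimeLocal
open Summit.AtomisticToContinuum.HydrodynamicLimit.Theorems.ContactBalance
open Summit.AtomisticToContinuum.HydrodynamicLimit.Theorems.SustainedAnisotropy
open Literature.MathematicalPhysics.KineticTheory (hsDiameter localGibbsLaw empiricalDensityField
  empiricalMomentumField ae_mem_good_localGibbsLaw)

noncomputable section

/-! ## The sub-block Reynolds hypothesis -/

/-- SUB-BLOCK REYNOLDS REMAINDER VANISHES on `[0, t]` for the block family `φ` at cell exponent `γc`: for every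
admissible cell family `ψ` at exponent `γc` and every `κ > 0`, `P_N{κ < ReynG φ ψ t} → 0` — the energy-weighted,
ψ-smeared fluctuation of the cell velocities about the block velocities, integrated over `[0, t] × 𝕋³`, is small
in probability (part (ii) of `stub_coarsening`; the hydro-class exposure shared with
`SustainedAnisotropy.ReynoldsStub`; NOT implied by the crux's conclusion). -/
def SubBlockReynoldsOn (σ : ℝ) (a₀ θ₀ : T3 → ℝ) (u₀ : T3 → V3) (Φ : Flows σ) (γc : ℝ) (φ : ℕ → T3 → ℝ)
    (t : ℝ) : Prop :=
  ∀ (C' : ℝ) (ψ : ℕ → T3 → ℝ), AdmissibleKernel γc C' ψ → ∀ κ : ℝ, 0 < κ →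
    Tendsto (fun N : ℕ => localGibbsLaw σ a₀ u₀ θ₀ N (Φ N) {z | κ < ReynG σ N (Φ N) φ ψ t z}) atTop (𝓝 0)

namespace Coarsening

/-! ## The crux's telescope is `DefectSq` -/

/-- Kinetic closure for a kernel family IS the vanishing in probability of `∫₀ᵗ∫ₓ DefectSq` (the crux's
`let ρb mb ub D q` telescope is `DefectSq` by `Reduction.cruxIntegrand_eq`). -/
theorem kineticClosureOn_iff_defectSq (σ : ℝ) (a₀ θ₀ : T3 → ℝ) (u₀ : T3 → V3) (Φ : Flows σ)
    (φ : ℕ → T3 → ℝ) (t : ℝ) :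
    KineticClosureOn σ a₀ θ₀ u₀ Φ φ t ↔ ∀ δ : ℝ, 0 < δ → Tendsto (fun N : ℕ => localGibbsLaw σ a₀ u₀ θ₀ N (Φ N)
      {z | δ < ∫ s in Icc 0 t, ∫ x, DefectSq σ N (Φ N) φ s z x}) atTop (𝓝 0) := by
  have hint : ∀ (N : ℕ) s z x,
    (∑ j, ∑ k, ((∫ y, φ N (y.1 - x) * ((y.2 j - ubar σ N (Φ N) φ s z x j) *
        (y.2 k - ubar σ N (Φ N) φ s z x k)) ∂(empiricalMeasure ((Φ N).flow s z))) -
      (if j = k then (∑ l : Fin 3, ∫ y, φ N (y.1 - x) * (y.2 l - ubar σ N (Φ N) φ s z x l) ^ 2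
        ∂(empiricalMeasure ((Φ N).flow s z))) / 3 else 0)) ^ 2) +
      ‖∫ y, (φ N (y.1 - x) * ‖y.2 - ubar σ N (Φ N) φ s z x‖ ^ 2 / 2) • (y.2 - ubar σ N (Φ N) φ s z x)
        ∂(empiricalMeasure ((Φ N).flow s z))‖ ^ 2 = DefectSq σ N (Φ N) φ s z x :=
    fun N s z x => Reduction.cruxIntegrand_eq (Φ N) φ s z x
  constructor
  · intro h δ hδ
    have h' := h δ hδ
    change Tendsto (fun N : ℕ => localGibbsLaw σ a₀ u₀ θ₀ N (Φ N) {z | δ < ∫ s in Icc 0 t, ∫ x,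
      ((∑ j, ∑ k, ((∫ y, φ N (y.1 - x) * ((y.2 j - ubar σ N (Φ N) φ s z x j) *
        (y.2 k - ubar σ N (Φ N) φ s z x k)) ∂(empiricalMeasure ((Φ N).flow s z))) -
      (if j = k then (∑ l : Fin 3, ∫ y, φ N (y.1 - x) * (y.2 l - ubar σ N (Φ N) φ s z x l) ^ 2
        ∂(empiricalMeasure ((Φ N).flow s z))) / 3 else 0)) ^ 2) +
      ‖∫ y, (φ N (y.1 - x) * ‖y.2 - ubar σ N (Φ N) φ s z x‖ ^ 2 / 2) • (y.2 - ubar σ N (Φ N) φ s z x)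
        ∂(empiricalMeasure ((Φ N).flow s z))‖ ^ 2)}) atTop (𝓝 0) at h'
    simp only [hint] at h'
    exact h'
  · intro h
    unfold KineticClosureOn
    intro ρb mb ub D q δ hδ
    have hint' : ∀ (N : ℕ) s z x, ((∑ j, ∑ k, D N s z x j k ^ 2) + ‖q N s z x‖ ^ 2) =
        DefectSq σ N (Φ N) φ s z x := fun N s z x => Reduction.cruxIntegrand_eq (Φ N) φ s z x
    simp only [hint']
    exact h δ hδ

/-! ## Scales: `R_N → 0` and `K_N → 0` -/

variable {γ C γc : ℝ} {φ : ℕ → T3 → ℝ}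

/-- `0 < R_N`. -/
theorem kvRad_pos (γ γc : ℝ) (N : ℕ) : 0 < kvRad γ γc N :=
  add_pos (Real.rpow_pos_of_pos (by positivity) _) (Real.rpow_pos_of_pos (by positivity) _)

/-- `R_N → 0` (`γ, γc > 0`); in particular `R_N < 1/2` eventually. -/
theorem tendsto_kvRad (hγ : 0 < γ) (hγc : 0 < γc) : Tendsto (kvRad γ γc) atTop (𝓝 0) := by
  have h := (PastDamping.tendsto_rpow_neg_succ hγ).add (PastDamping.tendsto_rpow_neg_succ hγc)
  rw [add_zero] at h
  exact h

/-- The kernel-variation constant `ε_N² R_N³ ≤ 24 C² (N+1)^{5γ − 2γc}` (`γ ≤ γc`). -/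
theorem kvLip_sq_mul_kvRad_cube_le (hadm : AdmissibleKernel γ C φ) (hγc : γ ≤ γc) (N : ℕ) :
    kvLip γ C γc N ^ 2 * kvRad γ γc N ^ 3 ≤ 24 * C ^ 2 * ((N : ℝ) + 1) ^ (5 * γ - 2 * γc) := by
  have hb : (0 : ℝ) < (N : ℝ) + 1 := by positivity
  have hb1 : (1 : ℝ) ≤ (N : ℝ) + 1 := by simp
  have hC := Pointwise.admissible_C_nonneg hadm
  -- `R_N ≤ 2 (N+1)^{-γ}`
  have hR : kvRad γ γc N ≤ 2 * ((N : ℝ) + 1) ^ (-γ) := by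
    unfold kvRad
    have : ((N : ℝ) + 1) ^ (-γc) ≤ ((N : ℝ) + 1) ^ (-γ) := Real.rpow_le_rpow_of_exponent_le hb1 (by linarith)
    linarith
  have hR0 := (kvRad_pos γ γc N).le
  -- `ε_N² = 3 C² (N+1)^{8γ} (N+1)^{-2γc}`
  have hε : kvLip γ C γc N ^ 2 = 3 * C ^ 2 * (((N : ℝ) + 1) ^ (4 * γ) * ((N : ℝ) + 1) ^ (4 * γ)) *
      (((N : ℝ) + 1) ^ (-γc) * ((N : ℝ) + 1) ^ (-γc)) := by
    unfold kvLip
    have h3 : Real.sqrt 3 ^ 2 = 3 := Real.sq_sqrt (by norm_num)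
    ring_nf
    rw [h3]
    ring
  rw [← Real.rpow_add hb, ← Real.rpow_add hb] at hε
  calc kvLip γ C γc N ^ 2 * kvRad γ γc N ^ 3
      ≤ kvLip γ C γc N ^ 2 * (2 * ((N : ℝ) + 1) ^ (-γ)) ^ 3 :=
        mul_le_mul_of_nonneg_left (pow_le_pow_left₀ hR0 hR 3) (sq_nonneg _)
    _ = 24 * C ^ 2 * (((N : ℝ) + 1) ^ (4 * γ + 4 * γ) * ((N : ℝ) + 1) ^ (-γc + -γc) *
          (((N : ℝ) + 1) ^ (-γ) * ((N : ℝ) + 1) ^ (-γ) * ((N : ℝ) + 1) ^ (-γ))) := by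
        rw [hε]; ring
    _ = 24 * C ^ 2 * ((N : ℝ) + 1) ^ (5 * γ - 2 * γc) := by
        rw [← Real.rpow_add hb, ← Real.rpow_add hb, ← Real.rpow_add hb, ← Real.rpow_add hb]
        congr 2
        ring

/-- **`K_N → 0`**: the kernel-variation prefactor `144 ε_N² R_N³ |B₁| 80` of the coarsening inequality tends to zero
as soon as `5γ < 2γc` (e.g. `γ ≤ 1/15`, `γc > 1/6`). -/
theorem tendsto_kvConst (hadm : AdmissibleKernel γ C φ) (hγc : γ ≤ γc) (h52 : 5 * γ < 2 * γc) :
    Tendsto (fun N : ℕ => 144 * (kvLip γ C γc N ^ 2 * (kvRad γ γc N ^ 3 * PastDamping.ballVol * 80)))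
      atTop (𝓝 0) := by
  have hup : Tendsto (fun N : ℕ => 144 * (24 * C ^ 2 * ((N : ℝ) + 1) ^ (5 * γ - 2 * γc) *
      PastDamping.ballVol * 80)) atTop (𝓝 0) := by
    have h := PastDamping.tendsto_rpow_neg_succ (γ := 2 * γc - 5 * γ) (by linarith)
    have e : ∀ N : ℕ, ((N : ℝ) + 1) ^ (5 * γ - 2 * γc) = ((N : ℝ) + 1) ^ (-(2 * γc - 5 * γ)) := fun N => by
      congr 1; ring
    simp_rw [e]
    simpa using ((h.const_mul (24 * C ^ 2)).mul_const PastDamping.ballVol).mul_const 80 |>.const_mul 144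
  refine tendsto_of_tendsto_of_tendsto_of_le_of_le tendsto_const_nhds hup (fun N => ?_) fun N => ?_
  · exact mul_nonneg (by norm_num) (mul_nonneg (sq_nonneg _) (mul_nonneg (mul_nonneg
      (pow_nonneg (kvRad_pos γ γc N).le 3) PastDamping.ballVol_nonneg) (by norm_num)))
  · have h := kvLip_sq_mul_kvRad_cube_le hadm hγc N
    have hbv := PastDamping.ballVol_nonneg
    nlinarith [mul_le_mul_of_nonneg_right h (mul_nonneg hbv (by norm_num : (0 : ℝ) ≤ 80))]

/-! ## Coarsening for one cell family -/

/-- **CELLS ⇒ BLOCKS FOR ONE CELL FAMILY.** For an admissible block family `φ` (`0 < γ ≤ 1/15`), an admissible cell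
family `ψ` (`1/6 < γc`), a flow family and a horizon with H2 on `[0, t]`: if the sub-block Reynolds remainder
`ReynG φ ψ t` and the cell defect `∫₀ᵗ∫ₓ DefectSq ψ` vanish in probability, so does the block defect. -/
theorem kineticClosureOn_of_cell {σ : ℝ} {a₀ θ₀ : T3 → ℝ} {u₀ : T3 → V3} {Φ : Flows σ} {γ C γc C' : ℝ}
    {φ ψ : ℕ → T3 → ℝ} (hγ : 0 < γ) (hγ' : γ ≤ 1 / 15) (hadm : AdmissibleKernel γ C φ) (hγc : 1 / 6 < γc)
    (hadmc : AdmissibleKernel γc C' ψ) {t : ℝ} (ht : 0 < t) (hT : TailsOn σ a₀ θ₀ u₀ Φ t)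
    (hRey : ∀ κ : ℝ, 0 < κ →
      Tendsto (fun N : ℕ => localGibbsLaw σ a₀ u₀ θ₀ N (Φ N) {z | κ < ReynG σ N (Φ N) φ ψ t z}) atTop (𝓝 0))
    (hcell : KineticClosureOn σ a₀ θ₀ u₀ Φ ψ t) : KineticClosureOn σ a₀ θ₀ u₀ Φ φ t := by
  rw [kineticClosureOn_iff_defectSq] at hcell ⊢
  intro δ hδ
  obtain ⟨lam, Cexp, hlam, hTail⟩ := hT
  -- the three good events' complements have vanishing probability
  have hA := hcell (δ / 12) (by positivity)
  have hB := hRey (δ / 3780) (by positivity)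
  -- scales
  have hγγc : γ ≤ γc := by linarith
  have h52 : 5 * γ < 2 * γc := by linarith
  have hRad : ∀ᶠ N : ℕ in atTop, kvRad γ γc N < 1 / 2 :=
    (tendsto_kvRad hγ (by linarith)).eventually (gt_mem_nhds (by norm_num))
  set M := 2 * t + 720 / lam ^ 6 * Cexp with hMdef
  have hKM : ∀ᶠ N : ℕ in atTop,
      144 * (kvLip γ C γc N ^ 2 * (kvRad γ γc N ^ 3 * PastDamping.ballVol * 80)) * M < δ / 3 := by
    have h := (tendsto_kvConst hadm hγγc h52).mul_const M
    rw [zero_mul] at h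
    exact (tendsto_order.1 h).2 _ (by positivity)
  -- the inclusion, for large `N`
  have hincl : ∀ᶠ N : ℕ in atTop, {z | δ < ∫ s in Icc 0 t, ∫ x, DefectSq σ N (Φ N) φ s z x} ⊆
      (((Φ N).goodᶜ ∪ {z | δ / 12 < ∫ s in Icc 0 t, ∫ x, DefectSq σ N (Φ N) ψ s z x}) ∪
        {z | δ / 3780 < ReynG σ N (Φ N) φ ψ t z}) ∪
        {z | Cexp < ∫ s in Icc 0 t, ∫ y, Real.exp (lam * ‖y.2‖ ^ 2) ∂(empiricalMeasure ((Φ N).flow s z))} := by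
    filter_upwards [hRad, hKM] with N hRN hKN z hz
    by_contra hnot
    simp only [mem_union, mem_compl_iff, mem_setOf_eq, not_or, not_not, not_lt] at hnot
    obtain ⟨⟨⟨hzG, hXψ⟩, hRG⟩, hTl⟩ := hnot
    have hmain := xint_le_orbit (Φ N) hadm hadmc hzG (kvRad_pos γ γc N) hRN t
    have hm6 := integral_m6_le (Φ N) hzG hlam ht.le
    rw [PastDamping.tails_integral_eq] at hTl
    have hK0 : 0 ≤ 144 * (kvLip γ C γc N ^ 2 * (kvRad γ γc N ^ 3 * PastDamping.ballVol * 80)) :=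
      mul_nonneg (by norm_num) (mul_nonneg (sq_nonneg _) (mul_nonneg (mul_nonneg
        (pow_nonneg (kvRad_pos γ γc N).le 3) PastDamping.ballVol_nonneg) (by norm_num)))
    have hmom : ∫ s in Icc 0 t, ((N + 1 : ℕ) : ℝ)⁻¹ * ∑ i : Fin (N + 1), (1 + ‖((Φ N).flow s z i).2‖ ^ 6) ≤ M := by
      refine hm6.trans ?_
      rw [hMdef]
      have : 0 ≤ 720 / lam ^ 6 := by positivity
      nlinarith
    have hE : δ < ∫ s in Icc 0 t, ∫ x, DefectSq σ N (Φ N) φ s z x := hz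
    have hKm := mul_le_mul_of_nonneg_left hmom hK0
    linarith
  -- the union bound
  have hnull : ∀ N : ℕ, localGibbsLaw σ a₀ u₀ θ₀ N (Φ N) (Φ N).goodᶜ = 0 := fun N =>
    ae_iff.1 (ae_mem_good_localGibbsLaw σ a₀ u₀ θ₀ N (Φ N))
  have hle : ∀ᶠ N : ℕ in atTop, localGibbsLaw σ a₀ u₀ θ₀ N (Φ N)
      {z | δ < ∫ s in Icc 0 t, ∫ x, DefectSq σ N (Φ N) φ s z x} ≤
      localGibbsLaw σ a₀ u₀ θ₀ N (Φ N) {z | δ / 12 < ∫ s in Icc 0 t, ∫ x, DefectSq σ N (Φ N) ψ s z x} +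
        localGibbsLaw σ a₀ u₀ θ₀ N (Φ N) {z | δ / 3780 < ReynG σ N (Φ N) φ ψ t z} +
        localGibbsLaw σ a₀ u₀ θ₀ N (Φ N)
          {z | Cexp < ∫ s in Icc 0 t, ∫ y, Real.exp (lam * ‖y.2‖ ^ 2) ∂(empiricalMeasure ((Φ N).flow s z))} := by
    filter_upwards [hincl] with N hN
    calc _ ≤ localGibbsLaw σ a₀ u₀ θ₀ N (Φ N) ((((Φ N).goodᶜ ∪
          {z | δ / 12 < ∫ s in Icc 0 t, ∫ x, DefectSq σ N (Φ N) ψ s z x}) ∪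
          {z | δ / 3780 < ReynG σ N (Φ N) φ ψ t z}) ∪
          {z | Cexp < ∫ s in Icc 0 t, ∫ y, Real.exp (lam * ‖y.2‖ ^ 2) ∂(empiricalMeasure ((Φ N).flow s z))}) :=
          measure_mono hN
      _ ≤ localGibbsLaw σ a₀ u₀ θ₀ N (Φ N) (Φ N).goodᶜ +
          localGibbsLaw σ a₀ u₀ θ₀ N (Φ N) {z | δ / 12 < ∫ s in Icc 0 t, ∫ x, DefectSq σ N (Φ N) ψ s z x} +
          localGibbsLaw σ a₀ u₀ θ₀ N (Φ N) {z | δ / 3780 < ReynG σ N (Φ N) φ ψ t z} +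
          localGibbsLaw σ a₀ u₀ θ₀ N (Φ N)
            {z | Cexp < ∫ s in Icc 0 t, ∫ y, Real.exp (lam * ‖y.2‖ ^ 2) ∂(empiricalMeasure ((Φ N).flow s z))} :=
          (measure_union_le _ _).trans (add_le_add ((measure_union_le _ _).trans
            (add_le_add (measure_union_le _ _) le_rfl)) le_rfl)
      _ = _ := by rw [hnull N, zero_add]
  have hsum : Tendsto (fun N : ℕ =>
      localGibbsLaw σ a₀ u₀ θ₀ N (Φ N) {z | δ / 12 < ∫ s in Icc 0 t, ∫ x, DefectSq σ N (Φ N) ψ s z x} +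
        localGibbsLaw σ a₀ u₀ θ₀ N (Φ N) {z | δ / 3780 < ReynG σ N (Φ N) φ ψ t z} +
        localGibbsLaw σ a₀ u₀ θ₀ N (Φ N)
          {z | Cexp < ∫ s in Icc 0 t, ∫ y, Real.exp (lam * ‖y.2‖ ^ 2) ∂(empiricalMeasure ((Φ N).flow s z))})
      atTop (𝓝 0) := by
    simpa using (hA.add hB).add hTail
  exact tendsto_of_tendsto_of_tendsto_of_le_of_le' tendsto_const_nhds hsum
    (Eventually.of_forall fun N => bot_le) hle

/-- **CELLS ⇒ BLOCKS** given the sub-block Reynolds hypothesis: for an admissible block family `φ`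
(`0 < γ ≤ 1/15`), `1/6 < γc`, a flow family and a horizon with H2 on `[0, t]`: if `SubBlockReynoldsOn … γc φ t`
holds and EVERY admissible cell family at exponent `γc` is kinetically closed on `[0, t]`, then `φ` is. -/
theorem kineticClosureOn_of_subBlockReynolds {σ : ℝ} {a₀ θ₀ : T3 → ℝ} {u₀ : T3 → V3} {Φ : Flows σ}
    {γ C γc : ℝ} {φ : ℕ → T3 → ℝ} (hγ : 0 < γ) (hγ' : γ ≤ 1 / 15) (hadm : AdmissibleKernel γ C φ)
    (hγc : 1 / 6 < γc) {t : ℝ} (ht : 0 < t) (hT : TailsOn σ a₀ θ₀ u₀ Φ t)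
    (hRey : SubBlockReynoldsOn σ a₀ θ₀ u₀ Φ γc φ t)
    (hcell : ∀ (C' : ℝ) (ψ : ℕ → T3 → ℝ), AdmissibleKernel γc C' ψ → KineticClosureOn σ a₀ θ₀ u₀ Φ ψ t) :
    KineticClosureOn σ a₀ θ₀ u₀ Φ φ t := by
  obtain ⟨C', ψ, hadmc⟩ := exists_admissibleKernel (γ := γc) (by linarith)
  exact kineticClosureOn_of_cell hγ hγ' hadm hγc hadmc ht hT (hRey C' ψ hadmc) (hcell C' ψ hadmc)

end Coarsening

/-- **S6 — COARSENING, CONDITIONAL ON THE SUB-BLOCK REYNOLDS REMAINDER** (registered anchor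
`bhCoarsening_of_reynolds` of the crux item stmt-AtomisticToContinuum-14868: the registered stub `stub_coarsening`
with the hypothesis `SubBlockReynoldsOn σ a₀ θ₀ u₀ Φ γc φ t` inserted after `TailsOn σ a₀ θ₀ u₀ Φ t`). For nice
profiles, `0 < σ < 1/2`, `γc ∈ (1/6, 1/3)`, every flow family, every admissible block family `φ` (`γ ≤ 1/15`) and
`t > 0` with H2 on `[0, t]`: if the sub-block Reynolds remainder vanishes and every admissible cell family at
exponent `γc` is kinetically closed on `[0, t]`, then `φ` is kinetically closed on `[0, t]`. (`NiceProfiles`,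
`0 < σ < 1/2` and `γc < 1/3` are not used.) -/
theorem bhCoarsening_of_reynolds : ∀ (a₀ θ₀ : T3 → ℝ) (u₀ : T3 → V3), NiceProfiles a₀ θ₀ u₀ → ∀ σ : ℝ, 0 < σ → σ < 2⁻¹ → ∀ γc : ℝ, 1 / 6 < γc → γc < 1 / 3 → ∀ Φ : Flows σ, ∀ (γ C : ℝ) (φ : ℕ → T3 → ℝ), 0 < γ → γ ≤ 1 / 15 → AdmissibleKernel γ C φ → ∀ t : ℝ, 0 < t → TailsOn σ a₀ θ₀ u₀ Φ t → SubBlockReynoldsOn σ a₀ θ₀ u₀ Φ γc φ t → (∀ (C' : ℝ) (ψ : ℕ → T3 → ℝ), AdmissibleKernel γc C' ψ → KineticClosureOn σ a₀ θ₀ u₀ Φ ψ t) → KineticClosureOn σ a₀ θ₀ u₀ Φ φ t :=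
  fun _ _ _ _ _ _ _ _ hγc _ _ _ _ _ hγ hγ' hadm _ ht hT hRey hcell =>
    Coarsening.kineticClosureOn_of_subBlockReynolds hγ hγ' hadm hγc ht hT hRey hcell

end

end Summit.AtomisticToContinuum.HydrodynamicLimit.Theorems.BlockHDissipation
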